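import Summits.RiemannHypothesis.RiemannHypothesis.Theorems.SemilocalNegCertThirteenKinked1423
import HarnessLib

/-!
# Semi-local threshold of the `{∞,2,…,13}` form, negative side: `a*({2,…,13}) ≤ 1457/1024` — the wall `q = 17` from a KINKED (piecewise-cubic) witness (part 6/12: the kernel facts piece 64 … piece 76 of 127 (imports part 1 only))

Cell `rh-explicit` (HOME `run/shared/lean/pub/rh-explicit/`), seat cc-s2-9 gen0 (HUMAN RULING D-0074 (D5) WEIL data engine; LADDER-RH column WEIL, rung DATA → W-P(P2);
pipeline = cc-s2-4 gen8/gen11's piecewise-witness layer `SemilocalPiecewise{Witness,Increment,IncrementSum,Cert}.lean` + their float finder, every number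
re-derived by an independent second engine E2 before filing).  HONEST FRAMING: RH-FREE theorems about the tree's `weilSemilocalThreshold S` of a
TRUNCATED Weil form (finitely many places); nothing here bears on the truth of RH; the lower clause `(log q)/2 ≤ a*(S_q)` at all primes IS RH and is untouched.

WHY KINKED (cc-s2-4 `KNEE-NOTE`): at `b ≈ a*(S_17) + 0.006` the polynomial × indicator class is still flat (tree row `143/100` at degree 15,
`SemilocalNegCertThirteen`, `δ*(17) ≤ 0.0134`), whereas an odd piecewise cubic with slope breaks at ALL TEN atom images `|b − log n|`
(`n = 4, 5, 3, 7, 8, 2, 9, 11, 13, 16`, rounded to `/1024`) is negative by `4.0·10⁻³‖G‖²`.  Instance: `S = {2,3,5,7,11,13}`, `b = 1457/1024 = 1.4228515625`,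
`N = 17` (atom table `atomsThirteen` / `atomsEnclose_Thirteen` of `SemilocalNegCertThirteen.lean`), 11 pieces of degree ≤ 3, 127 `t`-pieces; TWO ENGINES on the
witness before the kernel: cc-s2-4's float finder `λ_min = −4.0458·10⁻³` (kit j249062) and this seat's exact-in-`x` decimal engine E2 `R = −4.04459·10⁻³`
(no polar credit; E2 reproduces the tree rows `certSeventeen` → −3.7949·10⁻⁵ and `certElevenKinked129` → −3.5513·10⁻³); exact kernel margin `(rhs − lhs)/‖G‖² = 4.042·10⁻³` (farm report; majorant slack 2.4·10⁻⁶).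
⇒ **`a*({2,…,13}) ≤ 1457/1024`, `δ*(17) = a*(S_17) − (log 17)/2 ≤ 0.006245`** (was `0.0134`); DATA (cc-s2-6/cc-s2-3, two engines): `a*(S_17) = 1.41684`, `δ*(17) ≈ 2.3·10⁻⁴`.
No data is trusted: every bound is a `decide +kernel` fact of `SemilocalPiecewiseCert.lean`.  Folklore throughout.
-/

set_option autoImplicit false
set_option linter.dupNamespace false  -- the mandated namespace repeats `RiemannHypothesis`
set_option Elab.async false  -- serialise the kernel facts: in parallel they exhaust the node's per-process heap (cc-s2-4 gen11, CC4-LEAN §16.10)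

noncomputable section

open Complex Filter Set MeasureTheory Topology
open scoped Real

namespace Summit.RiemannHypothesis.RiemannHypothesis.Theorems.SemilocalPolyWitness

open MeasureTheory Set Finset Real
open Literature.NumberTheory.LFunctions
open Summit.RiemannHypothesis.RiemannHypothesis.Theorems.MotivicDoor
open Summit.RiemannHypothesis.RiemannHypothesis.Theorems.MotivicDoor.SemilocalThreshold
open Summit.RiemannHypothesis.RiemannHypothesis.Theorems.MotivicDoor.SemilocalMarkov
open LQ

set_option maxHeartbeats 0 in
/-- kernel fact: piece `64` of `certThirteenKinked1423`. -/
theorem check_ThirteenKinked1423_piece64 : certThirteenKinked1423.checkPiecePW 64 = true := by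
  decide +kernel

set_option maxHeartbeats 0 in
/-- kernel fact: piece `65` of `certThirteenKinked1423`. -/
theorem check_ThirteenKinked1423_piece65 : certThirteenKinked1423.checkPiecePW 65 = true := by
  decide +kernel

set_option maxHeartbeats 0 in
/-- kernel fact: piece `66` of `certThirteenKinked1423`. -/
theorem check_ThirteenKinked1423_piece66 : certThirteenKinked1423.checkPiecePW 66 = true := by
  decide +kernel

set_option maxHeartbeats 0 in
/-- kernel fact: piece `67` of `certThirteenKinked1423`. -/
theorem check_ThirteenKinked1423_piece67 : certThirteenKinked1423.checkPiecePW 67 = true := by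
  decide +kernel

set_option maxHeartbeats 0 in
/-- kernel fact: piece `68` of `certThirteenKinked1423`. -/
theorem check_ThirteenKinked1423_piece68 : certThirteenKinked1423.checkPiecePW 68 = true := by
  decide +kernel

set_option maxHeartbeats 0 in
/-- kernel fact: piece `69` of `certThirteenKinked1423`. -/
theorem check_ThirteenKinked1423_piece69 : certThirteenKinked1423.checkPiecePW 69 = true := by
  decide +kernel

set_option maxHeartbeats 0 in
/-- kernel fact: piece `70` of `certThirteenKinked1423`. -/
theorem check_ThirteenKinked1423_piece70 : certThirteenKinked1423.checkPiecePW 70 = true := by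
  decide +kernel

set_option maxHeartbeats 0 in
/-- kernel fact: piece `71` of `certThirteenKinked1423`. -/
theorem check_ThirteenKinked1423_piece71 : certThirteenKinked1423.checkPiecePW 71 = true := by
  decide +kernel

set_option maxHeartbeats 0 in
/-- kernel fact: piece `72` of `certThirteenKinked1423`. -/
theorem check_ThirteenKinked1423_piece72 : certThirteenKinked1423.checkPiecePW 72 = true := by
  decide +kernel

set_option maxHeartbeats 0 in
/-- kernel fact: piece `73` of `certThirteenKinked1423`. -/
theorem check_ThirteenKinked1423_piece73 : certThirteenKinked1423.checkPiecePW 73 = true := by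
  decide +kernel

set_option maxHeartbeats 0 in
/-- kernel fact: piece `74` of `certThirteenKinked1423`. -/
theorem check_ThirteenKinked1423_piece74 : certThirteenKinked1423.checkPiecePW 74 = true := by
  decide +kernel

set_option maxHeartbeats 0 in
/-- kernel fact: piece `75` of `certThirteenKinked1423`. -/
theorem check_ThirteenKinked1423_piece75 : certThirteenKinked1423.checkPiecePW 75 = true := by
  decide +kernel

set_option maxHeartbeats 0 in
/-- kernel fact: piece `76` of `certThirteenKinked1423`. -/
theorem check_ThirteenKinked1423_piece76 : certThirteenKinked1423.checkPiecePW 76 = true := by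
  decide +kernel

end Summit.RiemannHypothesis.RiemannHypothesis.Theorems.SemilocalPolyWitness

end
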